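import Mathlib
import Summits.Ventures.PercRepro2.PMK5Deg3Kernel
import Summits.Ventures.PercRepro2.PMK5Deg4Kernel
import Summits.Ventures.PercRepro2.PMK5Deg4Kernel5
import Summits.Ventures.PercRepro2.PMK5Deg5Kernel
import Summits.Ventures.PercRepro2.PMK5Deg5Kernel6
import Summits.Ventures.PercRepro2.PMK5Deg5LitsK60
import Summits.Ventures.PercRepro2.PMK5Deg5LitsK61
import Summits.Ventures.PercRepro2.PMK5Deg5LitsK62
import Summits.Ventures.PercRepro2.PMK5Deg5LitsK63
import Summits.Ventures.PercRepro2.PMK5Deg5LitsK64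
import Summits.Ventures.PercRepro2.PMK5Deg5LitsK65
import Summits.Ventures.PercRepro2.PMK5Deg5LitsK66
import Summits.Ventures.PercRepro2.PMK5Deg5LitsK67

/-!
# The table literals of `K₆`, six sliced edges, and their kernel certification, part 8 of 0–8
(blind cell PercRepro2, mine-2 g29; the degree-5 rung, `PMK5Deg5Kernel6.lean`)

`Lk6 i a b c d e f` is the `512`-bit vector of the `i`-th of the nineteen tables of `K₆` restricted to the edges
`9 ↦ a`, `10 ↦ b`, `11 ↦ c`, `12 ↦ d`, `13 ↦ e`, `14 ↦ f` (bit `idx2 ω` = the table at `ext6 ω a b c d e f`), generated by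
mining/mine-2/code/g29/lits6.c.  **`litOK_k6 : LitOK Lk6`** (part 8) certifies all `1216` literals against the tables in
the kernel (`lit_k6_ffffff`, …, `lit_k6_tttttt`: one `decide +kernel` per restriction, the bit tree `bits9` evaluated on the
`512` nine-edge configurations of each; part 0 = the literals (statement-only), parts 1–8 = eight certifications each).
The `4096` slice certificates `CertS Lk6 j₁ … j₆` are `PMK5Deg5CertsK6*.lean`.
-/

namespace Summit.Ventures.PercRepro2

namespace Deg5

namespace Six

set_option maxHeartbeats 0 in
set_option maxRecDepth 100000 in
/-- The literals of the restriction `fffttt` are the bit vectors of the restricted tables. -/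
theorem lit_k6_fffttt : ∀ i : Fin 19, Lk6 i false false false true true true = bits9 (res6 (tab i) false false false true true true) := by
  decide +kernel

set_option maxHeartbeats 0 in
set_option maxRecDepth 100000 in
/-- The literals of the restriction `tffttt` are the bit vectors of the restricted tables. -/
theorem lit_k6_tffttt : ∀ i : Fin 19, Lk6 i true false false true true true = bits9 (res6 (tab i) true false false true true true) := by
  decide +kernel

set_option maxHeartbeats 0 in
set_option maxRecDepth 100000 in
/-- The literals of the restriction `ftfttt` are the bit vectors of the restricted tables. -/
theorem lit_k6_ftfttt : ∀ i : Fin 19, Lk6 i false true false true true true = bits9 (res6 (tab i) false true false true true true) := by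
  decide +kernel

set_option maxHeartbeats 0 in
set_option maxRecDepth 100000 in
/-- The literals of the restriction `ttfttt` are the bit vectors of the restricted tables. -/
theorem lit_k6_ttfttt : ∀ i : Fin 19, Lk6 i true true false true true true = bits9 (res6 (tab i) true true false true true true) := by
  decide +kernel

set_option maxHeartbeats 0 in
set_option maxRecDepth 100000 in
/-- The literals of the restriction `fftttt` are the bit vectors of the restricted tables. -/
theorem lit_k6_fftttt : ∀ i : Fin 19, Lk6 i false false true true true true = bits9 (res6 (tab i) false false true true true true) := by
  decide +kernel

set_option maxHeartbeats 0 in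
set_option maxRecDepth 100000 in
/-- The literals of the restriction `tftttt` are the bit vectors of the restricted tables. -/
theorem lit_k6_tftttt : ∀ i : Fin 19, Lk6 i true false true true true true = bits9 (res6 (tab i) true false true true true true) := by
  decide +kernel

set_option maxHeartbeats 0 in
set_option maxRecDepth 100000 in
/-- The literals of the restriction `fttttt` are the bit vectors of the restricted tables. -/
theorem lit_k6_fttttt : ∀ i : Fin 19, Lk6 i false true true true true true = bits9 (res6 (tab i) false true true true true true) := by
  decide +kernel

set_option maxHeartbeats 0 in
set_option maxRecDepth 100000 in
/-- The literals of the restriction `tttttt` are the bit vectors of the restricted tables. -/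
theorem lit_k6_tttttt : ∀ i : Fin 19, Lk6 i true true true true true true = bits9 (res6 (tab i) true true true true true true) := by
  decide +kernel

/-- **The table literals of `K₆` are correct.** -/
theorem litOK_k6 : LitOK Lk6 := by
  intro i a b c d e f
  cases a <;> cases b <;> cases c <;> cases d <;> cases e <;> cases f
  · exact lit_k6_ffffff i
  · exact lit_k6_ffffft i
  · exact lit_k6_fffftf i
  · exact lit_k6_fffftt i
  · exact lit_k6_ffftff i
  · exact lit_k6_ffftft i
  · exact lit_k6_fffttf i
  · exact lit_k6_fffttt i
  · exact lit_k6_fftfff i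
  · exact lit_k6_fftfft i
  · exact lit_k6_fftftf i
  · exact lit_k6_fftftt i
  · exact lit_k6_ffttff i
  · exact lit_k6_ffttft i
  · exact lit_k6_fftttf i
  · exact lit_k6_fftttt i
  · exact lit_k6_ftffff i
  · exact lit_k6_ftffft i
  · exact lit_k6_ftfftf i
  · exact lit_k6_ftfftt i
  · exact lit_k6_ftftff i
  · exact lit_k6_ftftft i
  · exact lit_k6_ftfttf i
  · exact lit_k6_ftfttt i
  · exact lit_k6_fttfff i
  · exact lit_k6_fttfft i
  · exact lit_k6_fttftf i
  · exact lit_k6_fttftt i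
  · exact lit_k6_ftttff i
  · exact lit_k6_ftttft i
  · exact lit_k6_fttttf i
  · exact lit_k6_fttttt i
  · exact lit_k6_tfffff i
  · exact lit_k6_tfffft i
  · exact lit_k6_tffftf i
  · exact lit_k6_tffftt i
  · exact lit_k6_tfftff i
  · exact lit_k6_tfftft i
  · exact lit_k6_tffttf i
  · exact lit_k6_tffttt i
  · exact lit_k6_tftfff i
  · exact lit_k6_tftfft i
  · exact lit_k6_tftftf i
  · exact lit_k6_tftftt i
  · exact lit_k6_tfttff i
  · exact lit_k6_tfttft i
  · exact lit_k6_tftttf i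
  · exact lit_k6_tftttt i
  · exact lit_k6_ttffff i
  · exact lit_k6_ttffft i
  · exact lit_k6_ttfftf i
  · exact lit_k6_ttfftt i
  · exact lit_k6_ttftff i
  · exact lit_k6_ttftft i
  · exact lit_k6_ttfttf i
  · exact lit_k6_ttfttt i
  · exact lit_k6_tttfff i
  · exact lit_k6_tttfft i
  · exact lit_k6_tttftf i
  · exact lit_k6_tttftt i
  · exact lit_k6_ttttff i
  · exact lit_k6_ttttft i
  · exact lit_k6_tttttf i
  · exact lit_k6_tttttt i

end Six

end Deg5

end Summit.Ventures.PercRepro2
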